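import Summits.QuantumAdvantage.QuantumAdvantage.Theorems.LinnikCubicClassGroupsDegreeOnePrimesEscapeUpperShadow
import Literature.NumberTheory.LFunctions.UniformClassGroupPNTInputs
import HarnessLib

/-!
# Crux `DegreeOnePrimesEscape` (stmt-QuantumAdvantage-11543) — the printed Thorner–Zaman theorem implies the ADDITIVE dichotomy

Line `dedekind-s3-collision`, registered stub `stub_additiveOfTZ`.  The crux's one remaining analytic
debt is made precise and WEAKER: the dock consumes the Thorner–Zaman class prime number theorem
(`ThornerZaman2019_classPNT_hilbertClassField`, TZ 2019 Thm 1.4 for the Hilbert class field, relative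
error `c₃E(x)` times the possibly depleted main term) only through the **additive dichotomy**
  (∃ c₁ : ℝ, 0 < c₁ ∧ ∀ (K : Type) [Field K] [NumberField K], 1 < Module.finrank ℚ K →
        ((∀ (C : ClassGroup (𝓞 K)) (x : ℝ), ThornerZaman.condQn K ^ c₁ ≤ x →
            |(primeIdealClassCount K C x : ℝ) - offsetLogIntegral x / NumberField.classNumber K| ≤
              offsetLogIntegral x / (32 * NumberField.classNumber K)) ∨
          ∃ (χ₁ : ClassGroup (𝓞 K) →* ℂˣ) (β₁ : ℝ), χ₁ * χ₁ = 1 ∧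
            1 - 1 / (8 * Real.log (ThornerZaman.condQn K)) < β₁ ∧ β₁ < 1 ∧
            classGroupLFunction K χ₁ β₁ = 0 ∧
            ∀ (C : ClassGroup (𝓞 K)) (x : ℝ), ThornerZaman.condQn K ^ c₁ ≤ x →
              |(primeIdealClassCount K C x : ℝ) -
                  (offsetLogIntegral x - ((χ₁ C : ℂ)).re * offsetLogIntegral (x ^ β₁)) /
                    NumberField.classNumber K| ≤
                offsetLogIntegral x / (32 * NumberField.classNumber K)))
(absolute `c₁`; additive error `Li(x)/(32h)` per class; the real exceptional character `χ₁` and its real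
zero `β₁ ∈ (1 − 1/(8 log Q), 1)` of `L(s, χ₁)` kept).  This file proves that the printed fact implies it
(so discharging TZ still closes the line): with `C₀` large enough that `2c₃·E(x) ≤ 1/32` for `x ≥ Q^{C₀}`
(`Dock.errorTermN_le_of_ge`), the relative bound `c₃E·m_C/h` is at most `(1/64)·2Li/h` because
`0 ≤ m_C ≤ Li(x) + Li(x^{β₁}) ≤ 2Li(x)` (`Li` increasing, `2 ≤ x^{β₁} ≤ x`).  The additive form is
the statement a Literature discharge should target: it needs NO Deuring–Heilbronn zero repulsion
(zero-free region + Landau–Page + log-free zero density + explicit formula, all in the tree for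
`n ≤ 4` except the log-free density for `ζ₁_K` beyond `n ≤ 2`).
-/

noncomputable section

open scoped NumberField nonZeroDivisors
open Literature.NumberTheory.LFunctions Literature.NumberTheory.LFunctions.NumberField

namespace Summit.QuantumAdvantage.QuantumAdvantage.Theorems.DegreeOnePrimesEscape

/-- **Registered stub `stub_additiveOfTZ`** (line `dedekind-s3-collision`): the printed Thorner–Zaman
fact implies the additive dichotomy with error `Li(x)/(32h)`. -/
theorem stub_additiveOfTZ : ThornerZaman2019_classPNT_hilbertClassField →
    (∃ c₁ : ℝ, 0 < c₁ ∧ ∀ (K : Type) [Field K] [NumberField K], 1 < Module.finrank ℚ K →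
      ((∀ (C : ClassGroup (𝓞 K)) (x : ℝ), ThornerZaman.condQn K ^ c₁ ≤ x →
          |(primeIdealClassCount K C x : ℝ) - offsetLogIntegral x / NumberField.classNumber K| ≤
            offsetLogIntegral x / (32 * NumberField.classNumber K)) ∨
        ∃ (χ₁ : ClassGroup (𝓞 K) →* ℂˣ) (β₁ : ℝ), χ₁ * χ₁ = 1 ∧
          1 - 1 / (8 * Real.log (ThornerZaman.condQn K)) < β₁ ∧ β₁ < 1 ∧
          classGroupLFunction K χ₁ β₁ = 0 ∧
          ∀ (C : ClassGroup (𝓞 K)) (x : ℝ), ThornerZaman.condQn K ^ c₁ ≤ x →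
            |(primeIdealClassCount K C x : ℝ) -
                (offsetLogIntegral x - ((χ₁ C : ℂ)).re * offsetLogIntegral (x ^ β₁)) /
                  NumberField.classNumber K| ≤
              offsetLogIntegral x / (32 * NumberField.classNumber K))) := by
  intro hTZ
  obtain ⟨c₁, c₂, c₃, hc₁, hc₂, hc₃, H⟩ := hTZ
  have hc₃2 : 0 < 2 * c₃ := by positivity
  set L : ℝ := max 1 (Real.log (64 * (2 * c₃))) with hLdef
  set C₀ : ℝ := max (max c₁ 1) (max (L / c₂) (L ^ 2 / (c₂ * Real.log 2))) with hC₀def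
  have hC₀c₁ : c₁ ≤ C₀ := le_trans (le_max_left _ _) (le_max_left _ _)
  have hC₀1 : 1 ≤ C₀ := le_trans (le_max_right _ _) (le_max_left _ _)
  refine ⟨C₀, by linarith, fun K _ _ hK => ?_⟩
  set Q : ℝ := ThornerZaman.condQn K with hQdef
  set h : ℕ := NumberField.classNumber K with hhdef
  have hQ12 : 12 ≤ Q := ThornerZaman.twelve_le_condQn (K := K) hK
  have hQ1 : 1 ≤ Q := by linarith
  have hhpos : (0 : ℝ) < h := by exact_mod_cast NumberField.classNumber_pos (K := K)
  -- uniform facts at every admissible `x`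
  have hxfacts : ∀ x : ℝ, Q ^ C₀ ≤ x →
      Q ^ c₁ ≤ x ∧ 12 ≤ x ∧ c₃ * ThornerZaman.errorTermN c₂ Q (Module.finrank ℚ K) x ≤ 1 / 64 := by
    intro x hx
    refine ⟨le_trans (Real.rpow_le_rpow_of_exponent_le hQ1 hC₀c₁) hx, ?_, ?_⟩
    · calc (12 : ℝ) ≤ Q := hQ12
        _ = Q ^ (1 : ℝ) := (Real.rpow_one Q).symm
        _ ≤ Q ^ C₀ := Real.rpow_le_rpow_of_exponent_le hQ1 hC₀1
        _ ≤ x := hx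
    · have hE : (2 * c₃) * ThornerZaman.errorTermN c₂ Q (Module.finrank ℚ K) x ≤ 1 / 32 :=
        Dock.errorTermN_le_of_ge hc₂ hc₃2 (le_trans (le_max_left _ _) (le_max_right _ _))
          (le_trans (le_max_right _ _) (le_max_right _ _)) K hK hx
      linarith
  -- Li(y) ≥ 0 for y ≥ 2 and monotonicity
  have hLimono := strictMonoOn_offsetLogIntegral_holds
  have hLi_nonneg : ∀ y : ℝ, 2 ≤ y → 0 ≤ offsetLogIntegral y := by
    intro y hy
    rcases eq_or_lt_of_le hy with h2 | h2
    · rw [← h2, offsetLogIntegral_two]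
    · have := hLimono (show (2:ℝ) ∈ Set.Ioi 1 by norm_num) (show y ∈ Set.Ioi 1 from by
        simp only [Set.mem_Ioi]; linarith) h2
      rw [offsetLogIntegral_two] at this; exact this.le
  have hLi_mono : ∀ y z : ℝ, 2 ≤ y → y ≤ z → offsetLogIntegral y ≤ offsetLogIntegral z := by
    intro y z hy hyz
    rcases eq_or_lt_of_le hyz with h2 | h2
    · rw [h2]
    · exact (hLimono (show y ∈ Set.Ioi 1 from by simp only [Set.mem_Ioi]; linarith)
        (show z ∈ Set.Ioi 1 from by simp only [Set.mem_Ioi]; linarith) h2).le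
  have hEpos : ∀ x : ℝ, 0 < c₃ * ThornerZaman.errorTermN c₂ Q (Module.finrank ℚ K) x :=
    fun x => mul_pos hc₃ (ThornerZaman.errorTermN_pos _ _ _ _)
  -- a relative bound with a nonnegative bound forces `m ≥ 0`, and then is additive
  have key : ∀ (x π m : ℝ), |π - m / h| ≤ c₃ * ThornerZaman.errorTermN c₂ Q (Module.finrank ℚ K) x * (m / h) →
      c₃ * ThornerZaman.errorTermN c₂ Q (Module.finrank ℚ K) x ≤ 1 / 64 → m ≤ 2 * offsetLogIntegral x →
      |π - m / h| ≤ offsetLogIntegral x / (32 * h) := by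
    intro x π m hπ hE hm2
    have hm : 0 ≤ m / h := by
      by_contra hneg
      rw [not_le] at hneg
      have : c₃ * ThornerZaman.errorTermN c₂ Q (Module.finrank ℚ K) x * (m / h) < 0 :=
        mul_neg_of_pos_of_neg (hEpos x) hneg
      linarith [abs_nonneg (π - m / h)]
    refine hπ.trans ?_
    have h1 : c₃ * ThornerZaman.errorTermN c₂ Q (Module.finrank ℚ K) x * (m / h) ≤ 1 / 64 * (m / h) :=
      mul_le_mul_of_nonneg_right hE hm
    have h2 : 1 / 64 * (m / h) ≤ offsetLogIntegral x / (32 * h) := by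
      have : m / h ≤ 2 * offsetLogIntegral x / h := div_le_div_of_nonneg_right hm2 hhpos.le
      have e : offsetLogIntegral x / (32 * h) = 1 / 64 * (2 * offsetLogIntegral x / h) := by
        field_simp; ring
      rw [e]
      exact mul_le_mul_of_nonneg_left this (by norm_num)
    exact h1.trans h2
  rcases H K hK with ⟨-, hA⟩ | ⟨χ₁, β₁, hreal, hβlo, hβhi, hzero, hB⟩
  · left
    intro C x hx
    obtain ⟨hxc₁, hx12, hE⟩ := hxfacts x hx
    have hLix : 0 ≤ offsetLogIntegral x := hLi_nonneg x (by linarith)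
    exact key x _ _ (hA C x hxc₁) hE (by linarith)
  · right
    refine ⟨χ₁, β₁, hreal, hβlo, hβhi, hzero, fun C x hx => ?_⟩
    obtain ⟨hxc₁, hx12, hE⟩ := hxfacts x hx
    have hLix : 0 ≤ offsetLogIntegral x := hLi_nonneg x (by linarith)
    -- 2 ≤ x^β₁ ≤ x, so 0 ≤ Li(x^β₁) ≤ Li(x)
    have hβhalf : (1:ℝ) / 2 ≤ β₁ := by
      have hlogQ : Real.log 12 ≤ Real.log Q := Real.log_le_log (by norm_num) hQ12
      have hlog12 : (1 : ℝ) < Real.log 12 := by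
        have := Real.exp_one_lt_d9
        rw [Real.lt_log_iff_exp_lt (by norm_num)]; linarith
      have hlogQpos : 0 < Real.log Q := by linarith
      have : 1 / (8 * Real.log Q) ≤ 1 / 8 := by
        rw [div_le_div_iff₀ (by positivity) (by norm_num)]; nlinarith
      linarith
    have hx1 : (1:ℝ) ≤ x := by linarith
    have hxβ : 2 ≤ x ^ β₁ := by
      calc (2 : ℝ) ≤ 12 ^ ((1:ℝ) / 2) := by
            rw [show (12:ℝ) = 2 ^ (2:ℝ) * 3 by norm_num, Real.mul_rpow (by positivity) (by norm_num),
              ← Real.rpow_mul (by norm_num)]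
            norm_num
            have : (1:ℝ) ≤ (3:ℝ) ^ ((1:ℝ)/2) := Real.one_le_rpow (by norm_num) (by norm_num)
            linarith
        _ ≤ x ^ ((1:ℝ) / 2) := Real.rpow_le_rpow (by norm_num) hx12 (by norm_num)
        _ ≤ x ^ β₁ := Real.rpow_le_rpow_of_exponent_le hx1 hβhalf
    have hxβx : x ^ β₁ ≤ x := by
      calc x ^ β₁ ≤ x ^ (1 : ℝ) := Real.rpow_le_rpow_of_exponent_le hx1 hβhi.le
        _ = x := Real.rpow_one x
    have hLiβ0 : 0 ≤ offsetLogIntegral (x ^ β₁) := hLi_nonneg _ hxβ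
    have hLiβ : offsetLogIntegral (x ^ β₁) ≤ offsetLogIntegral x := hLi_mono _ _ hxβ hxβx
    have hre : |((χ₁ C : ℂ)).re| ≤ 1 := abs_re_classGroupChar_apply_le hreal C
    have hm2 : offsetLogIntegral x - ((χ₁ C : ℂ)).re * offsetLogIntegral (x ^ β₁) ≤ 2 * offsetLogIntegral x := by
      have h1 : -(((χ₁ C : ℂ)).re * offsetLogIntegral (x ^ β₁)) ≤ offsetLogIntegral (x ^ β₁) := by
        have := (abs_le.1 hre).1
        nlinarith
      linarith
    exact key x _ _ (hB C x hxc₁) hE hm2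

end Summit.QuantumAdvantage.QuantumAdvantage.Theorems.DegreeOnePrimesEscape

end
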